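import Summits.Ventures.PackingBounds.ThreePointCert.SoundNN
import Summits.Ventures.PackingBounds.ThreePointCert.CheckFastFZ
import Summits.Ventures.PackingBounds.ThreePointCert.K13d12ExpandR0p1
import Summits.Ventures.PackingBounds.ThreePointCert.K13d12ExpandR0p2
import Summits.Ventures.PackingBounds.ThreePointCert.K13d12ExpandR0p3
import Summits.Ventures.PackingBounds.ThreePointCert.K13d12ExpandR1p1
import Summits.Ventures.PackingBounds.ThreePointCert.K13d12ExpandR1p2
import Summits.Ventures.PackingBounds.ThreePointCert.K13d12ExpandR2p1
import Summits.Ventures.PackingBounds.ThreePointCert.K13d12ExpandR3p1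
import Summits.Ventures.PackingBounds.ThreePointCert.K13d12ExpandR4p1
import Summits.Ventures.PackingBounds.ThreePointCert.K13d12ExpandQG1
import Summits.Ventures.PackingBounds.ThreePointCert.K13d12ExpandQG2
import Summits.Ventures.PackingBounds.ThreePointCert.K13d12ExpandQG3
import Summits.Ventures.PackingBounds.ThreePointCert.K13d12ExpandQG4
import Summits.Ventures.PackingBounds.ThreePointCert.K13d12CheckA
import Summits.Ventures.PackingBounds.ThreePointCert.K13d12CheckB

/-!
# κ(13) ≤ 2080: the kernel-checked theorem

Framing: lottery ticket; floor = certified bounds/negative ranges. Venture `PackingBounds` (cell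
`pub-packcert`), three-point SDP family, kissing column. Integer data / kernel checks of a feasible point of the
Bachoc–Vallentin semidefinite program (n = 13, s = 1/2, three-point matrix degree 12, two-point (Gegenbauer) part to
degree L = 24, Bachoc–Vallentin multiplier set = cell mode sym2; exact rational certificate `sdp-n13-d12-s1-2-sym2-a24-hyb7-j141808.json`
(sha256 528063ee29f2b8195aa2d3b83a1c90c94bfacd2fca6f8246cc4bdbc5cb9eaa66) of the sdp seat's hybrid pipeline, verified by the cell's two exact verifiers), converted by
`cert2lean_g9.py` (lp gen 9; S = 68) into the units of the kernel checker `ThreePointCert.Check` + `CheckSym2` with the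
record degree field set to L = 24 (the checker's degree enters only the unit `W = 2^d·d!` and the side conditions, so a
(d, L) certificate is a `Cert3` of degree L); Gram factors offset-encoded for the Kronecker-packed chunk validation
`ThreePointCert.CheckKron`; split check of (ii') `ThreePointCert.CheckSym2Split`. Emitter `emitlean_g9s.py` (lp gen 9: coarse Gram factors `L′ ≈ L/2^k`,
expansions `4^k • zᵀ(L′L′ᵀ)z` lifted by `SoundNN.boxNonneg_smul`; layout of lp gen 8's K5d14 chain). Generated file: plain lists of integers / monomials.
-/

namespace Summit.Ventures.PackingBounds.ThreePointCert.K13d12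

open Literature.Geometry.DiscreteGeometry Literature.Geometry.DiscreteGeometry.PolyCert PolyCert.SPoly

set_option maxRecDepth 100000 in
/-- The expansion data are valid in the weak sense of `SoundNN.PolysNN3` (assembled from the kernel validations; Gram forms scaled by `boxNonneg_smul`). -/
theorem polys_nn : PolysNN3 K13d12.cert K13d12.polys where
  hF := fexpValidG_of_fchunkVal cert eFP _ (by rfl) (fchunkVal_append _ _ _ _ _ _ (fchunkVal_append _ _ _ _ _ _ (fchunkVal_append _ _ _ _ _ _ (fchunkVal_append _ _ _ _ _ _ (fchunkVal_append _ _ _ _ _ _ (fchunkVal_append _ _ _ _ _ _ (fchunkVal_append _ _ _ _ _ _ (fchunkVal_append _ _ _ _ _ _ (fchunkVal_append _ _ _ _ _ _ (fchunkVal_append _ _ _ _ _ _ (fchunkVal_append _ _ _ _ _ _ (fchunkVal_of_okFZ _ _ _ _ okF_1) (fchunkVal_of_okFZ _ _ _ _ okF_2)) (fchunkVal_of_okFZ _ _ _ _ okF_3)) (fchunkVal_of_okFZ _ _ _ _ okF_4)) (fchunkVal_of_okFZ _ _ _ _ okF_5)) (fchunkVal_of_okFZ _ _ _ _ okF_6))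 (fchunkVal_of_okFZ _ _ _ _ okF_7)) (fchunkVal_of_okFZ _ _ _ _ okF_8)) (fchunkVal_of_okFZ _ _ _ _ okF_9)) (fchunkVal_of_okFZ _ _ _ _ okF_10)) (fchunkVal_of_okFZ _ _ _ _ okF_11)) (fchunkVal_of_okFZ _ _ _ _ okF_12))
  h0 := boxNonneg_smul cR0 eR0s (boxNonneg_of_rvalid gR0K.toGramBlk eR0s (by
    have c := chunkVal_of_okK _ _ _ _ _ okR0_1
    have c := chunkVal_trans _ _ _ _ _ _ _ c (chunkVal_of_okK _ _ _ _ _ okR0_2)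
    have c := chunkVal_trans _ _ _ _ _ _ _ c (chunkVal_of_okK _ _ _ _ _ okR0_3)
    have c := chunkVal_trans _ _ _ _ _ _ _ c (chunkVal_of_okK _ _ _ _ _ okR0_4)
    have c := chunkVal_trans _ _ _ _ _ _ _ c (chunkVal_of_okK _ _ _ _ _ okR0_5)
    have c := chunkVal_trans _ _ _ _ _ _ _ c (chunkVal_of_okK _ _ _ _ _ okR0_6)
    have c := chunkVal_trans _ _ _ _ _ _ _ c (chunkVal_of_okK _ _ _ _ _ okR0_7)
    have c := chunkVal_trans _ _ _ _ _ _ _ c (chunkVal_of_okK _ _ _ _ _ okR0_8)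
    have c := chunkVal_trans _ _ _ _ _ _ _ c (chunkVal_of_okK _ _ _ _ _ okR0_9)
    have c := chunkVal_trans _ _ _ _ _ _ _ c (chunkVal_of_okK _ _ _ _ _ okR0_10)
    have c := chunkVal_trans _ _ _ _ _ _ _ c (chunkVal_of_okK _ _ _ _ _ okR0_11)
    exact c))
  h1 := boxNonneg_smul cR1 eR1s (boxNonneg_of_rvalid gR1K.toGramBlk eR1s (by
    have c := chunkVal_of_okK _ _ _ _ _ okR1_1
    have c := chunkVal_trans _ _ _ _ _ _ _ c (chunkVal_of_okK _ _ _ _ _ okR1_2)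
    have c := chunkVal_trans _ _ _ _ _ _ _ c (chunkVal_of_okK _ _ _ _ _ okR1_3)
    have c := chunkVal_trans _ _ _ _ _ _ _ c (chunkVal_of_okK _ _ _ _ _ okR1_4)
    have c := chunkVal_trans _ _ _ _ _ _ _ c (chunkVal_of_okK _ _ _ _ _ okR1_5)
    have c := chunkVal_trans _ _ _ _ _ _ _ c (chunkVal_of_okK _ _ _ _ _ okR1_6)
    exact c))
  h2 := boxNonneg_smul cR2 eR2s (boxNonneg_of_rvalid gR2K.toGramBlk eR2s (by
    have c := chunkVal_of_okK _ _ _ _ _ okR2_1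
    have c := chunkVal_trans _ _ _ _ _ _ _ c (chunkVal_of_okK _ _ _ _ _ okR2_2)
    have c := chunkVal_trans _ _ _ _ _ _ _ c (chunkVal_of_okK _ _ _ _ _ okR2_3)
    exact c))
  h3 := boxNonneg_smul cR3 eR3s (boxNonneg_of_rvalid gR3K.toGramBlk eR3s (by
    have c := chunkVal_of_okK _ _ _ _ _ okR3_1
    have c := chunkVal_trans _ _ _ _ _ _ _ c (chunkVal_of_okK _ _ _ _ _ okR3_2)
    exact c))
  h4 := boxNonneg_smul cR4 eR4s (boxNonneg_of_rvalid gR4K.toGramBlk eR4s (by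
    have c := chunkVal_of_okK _ _ _ _ _ okR4_1
    have c := chunkVal_trans _ _ _ _ _ _ _ c (chunkVal_of_okK _ _ _ _ _ okR4_2)
    have c := chunkVal_trans _ _ _ _ _ _ _ c (chunkVal_of_okK _ _ _ _ _ okR4_3)
    exact c))
  hq0 := boxNonneg_smul cQ0 eQ0s (boxNonneg_of_singleK gQ0K eQ0s okQ0_1)
  hq1 := boxNonneg_smul cQ1 eQ1s (boxNonneg_of_singleK gQ1K eQ1s okQ1_1)

set_option maxHeartbeats 0 in
/-- The side conditions hold. -/
theorem cert_side : checkSide3 K13d12.cert = true := by decide +kernel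

set_option maxHeartbeats 0 in
/-- The numerical bound is `< N + 1` (and `≥ 0`). -/
theorem cert_bound : checkBound3 K13d12.cert K13d12.polys = true := by decide +kernel

/-- **κ(13) ≤ 2080**: every finite set of unit vectors of `ℝ^13` with pairwise inner products
`≤ 1 / 2` has at most `2080` elements (kissing configurations of `ℝ^13`) — the Bachoc–Vallentin three-point (semidefinite
programming) bound with their original multiplier set, three-point matrix degree 12 with the two-point (Gegenbauer)
part to degree 24 (the sdp seat's hybrid pipeline, cell family hyb7), from the exact certificate
`sdp-n13-d12-s1-2-sym2-a24-hyb7-j141808.json` (bound value 2080.769166), kernel-checked (record degree field `d := 24`; split check of (ii'); coarse Gram factors lifted by `SoundNN`).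
[cite: BachocVallentin2007, Theorem 4.2] -/
theorem kissing_dim13_le_2080_sdp (C : Finset (EuclideanSpace ℝ (Fin 13)))
    (h1 : ∀ x ∈ C, ‖x‖ = 1) (h2 : ∀ x ∈ C, ∀ y ∈ C, x ≠ y → inner ℝ x y ≤ 1 / 2) :
    C.card ≤ 2080 :=
  card_le_of_cert3S2splitNN cert polys polys_nn cert_I polyM polyMM cert_IIa cert_IIb cert_IIc cert_side cert_bound C h1
    (fun x hx y hy hxy => by
      have h := h2 x hx y hy hxy
      have e : ((cert.p : ℤ) : ℝ) / (cert.q : ℕ) = 1 / 2 := by norm_num [cert]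
      rw [e]; exact h)

end Summit.Ventures.PackingBounds.ThreePointCert.K13d12
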